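import Literature.NumberTheory.GaloisRepresentations.IdeleClassBarSubgroupHOne
import Literature.NumberTheory.GaloisRepresentations.GalLayerEmbedding
import Literature.Algebra.Homology.TateNakayamaInflationVanishingPlain
import Literature.NumberTheory.Automorphic.IdeleClassGaloisRepInflation
import HarnessLib

/-!
# `Extʳ_{C_U}(ℤ, Res_U C̄) = 0` for `r ≥ 3` and every open subgroup `U ≤ Γ_F`: the hypothesis
# `Hʳ(U, C) = 0 (r ≥ 3)` of Tate's duality theorem for the idèle class formation
# (Milne ADT I Thm. 1.8 / Lemma 1.9; Harari Lemma 16.20; Tate, C–F VII §11.3 Thm. B)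

Topic `NumberTheory/GaloisRepresentations`; namespace `Literature.NumberTheory.GaloisRepresentations.IdeleClassBar`.
Theorems only; no definition, no named fact, no instance, no `sorry`.  Sequel to `IdeleClassBarSubgroupHOne.lean`
(door-c6 g15: the transfer `GalLayerData.ext_res_eq_zero_of_forall_relInf` — if every class of every relative layer
`Hⁿ(H_E, Res_{H_E} C_E)` dies under a relative inflation `relInf`, then `Extⁿ_{C_U}(ℤ, Res_U C̄) = 0`),
`GalLayerEmbedding.lean` (door-c6 g15: `GalLayer.exists_ge_finrank_dvd` — a layer `M ⊇ E` inside `F̄` with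
`[E:F] ∣ [M:E]`), `Algebra/Homology/TateNakayamaInflationVanishingPlain.lean` (door-c6 g15:
`IsClassModule.map_eq_zero_of_card_dvd_plain` — the Tate–Nakayama engine: `Hⁿ⁺³(G, C) → Hⁿ⁺³(G₁, C₁)` vanishes
when `Inf_π[φ] = d[φ₁]`, `|G| ∣ d`) and `Automorphic/IdeleClassGaloisRepInflation.lean` (door-c4 g11: compatible
fundamental classes `Inf u_E = [M:E]·u_M` for the idèle class layers).

THE POINT.  Door-c4's Tate duality theorem (`DiscreteRepTateDuality.TateDualityHypotheses`, p589490) asks, for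
`C̄ = classBarD F ∈ C_{Γ_F}`, at every open normal `U ≤ Γ_F`:
`ext_triv_eq_zero_of_three_le U : ∀ r ≥ 3, Extʳ_{C_U}(triv ℤ, Res_U C̄) = 0`.  THIS FILE DISCHARGES IT (for every open
`U`): **`ext_res_classBarD_eq_zero_of_three_le`**.  Proof (Milne's proof of Lemma 1.9 / Harari Lemma 16.20 at the
open subgroup `U`): `Extʳ_{C_U}(ℤ, Res_U C̄) = lim→_E Hʳ(H_E, Res C_E)` over the layers `E` with `U_E ≤ U`
(`H_E ≤ Gal(E/F)` the image of `U`), and for `r = n + 3` every transition `Hʳ(H_E, Res C_E) → Hʳ(H_M, Res C_M)`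
with `[E:F] ∣ [M:E]` is ZERO (`relInf_eq_zero_of_finrank_dvd`): `(H_E, Res C_E)` is a class module
(restriction of door-c4 g11's class-module structure on `(Gal(E/F), C_E)`), the compatible fundamental classes
`Inf u_E = [M:E]·u_M` restrict to the subgroups (`relInf_H2π_eq`: `relInf (res u_E) = [M:E] · res u_M`, from
`res_comp_relInf`), and `|H_E| ∣ [E:F] ∣ [M:E]`; such `M` exist inside `F̄` (`exists_ge_finrank_dvd`).

## What is formalised (`F : Type` a number field, `Γ = absoluteGaloisGroup F`, `U ≤ Γ` open)

* `classData_baseRepHom_hom_apply` (the base change of `classData` is `[x] ↦ [x_M]`), `relInf_res_H2π_eq`,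
  `relInf_H2π_mapCocycles₂_eq`,
  **`relInf_eq_zero_of_finrank_dvd`** (`Hⁿ⁺³(H_E, Res C_E) → Hⁿ⁺³(H_M, Res C_M)` is zero for `[E:F] ∣ [M:E]`).
* **`ext_res_classBarD_eq_zero_of_three_le`**: `Extʳ_{C_U}(ℤ, Res_U C̄) = 0` for `r ≥ 3` and every open `U ≤ Γ_F`;
  `ext_res_classBarD_eq_zero_of_three_le_openNormal` (door-c4's field verbatim);
  `inf_eq_zero_of_finrank_dvd` + `ext_classBarD_eq_zero_of_three_le` (the absolute case `U = Γ_F` through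
  door-c4's (d) and door-c5's `layerCohomologyIso`).

Written for Route A of the Poitou–Tate programme of crux `AnticycControlAdditiveK` (cell bsd-schneider, item 19295), seat
door-c6 gen 15.  HONEST FRAMING: this is ONE MORE of the six class-formation hypotheses of the abstract duality theorem
for `(Γ_F, C̄)` (with `IdeleClassBarSubgroupHOne`: two of six); no case of Poitou–Tate duality and no case of BSD is
proved here.

## References
* J. S. Milne, *Arithmetic Duality Theorems* (2nd ed. 2006), I §1, Theorem 1.8 and Lemma 1.9. [MilneADT2006]
* D. Harari, *Galois Cohomology and Class Field Theory* (2020), §16.1 Def. 16.2, §16.3 Lemma 16.20. [Harari2020]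
* J. W. S. Cassels, A. Fröhlich (eds.), *Algebraic Number Theory* (1967), Ch. VII (J. Tate) §11.3 Theorem B
  (`H^r(G, C) = 0`, `r ≥ 3` odd... via Tate–Nakayama). [CasselsFrohlichANT1967]
* J.-P. Serre, *Local Fields*, GTM 67 (1979), XI §3 (`Inf u_{F/E} = [F':F] u_{F'/E}`). [SerreLocalFields1979]
-/

noncomputable section

open CategoryTheory groupCohomology
open Field (absoluteGaloisGroup)
open Literature.Algebra.Homology
open Literature.NumberTheory.Automorphic Literature.NumberTheory.Automorphic.IdeleClassGroup
open scoped Classical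

namespace Literature.NumberTheory.GaloisRepresentations

namespace IdeleClassBar

variable {F : Type} [Field F] [NumberField F]

/-! ## §1 The relative transitions `Hⁿ⁺³(H_E, Res C_E) → Hⁿ⁺³(H_M, Res C_M)` vanish for `[E:F] ∣ [M:E]` -/

/-- The base change of the system `classData F` along `E ≤ M` is `[x] ↦ [x_M]` (`classBaseChange`), in the shape of the
hypothesis `hι` of the cell's inflation files. [cite: CasselsFrohlichANT1967, Ch. VII §11.1] -/
theorem classData_baseRepHom_hom_apply {E M : GalLayer F} (h : E ≤ M) (a : layerClass F E) :
    ((classData F).baseRepHom h).hom a =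
      (haveI := E.numberField; haveI := M.numberField; letI := GalLayer.algebraOfLE h;
        Additive.ofMul (classBaseChange E.1 M.1 (Additive.toMul (α := IdeleClassGroup E.1) a))) := by
  haveI := E.numberField
  haveI := M.numberField
  rw [GalLayerData.baseRepHom_hom_apply, classData_base_apply, transHom_eq_baseChangeHom]
  apply Additive.toMul.injective
  exact toMul_baseChangeHom h a

set_option maxHeartbeats 1600000 in
-- `ℤ`-instance paths (`Int.instSemiring` here vs the `CommRing ℤ` path inside `groupCohomology`) make `map_nsmul` slow
/-- **The compatible fundamental classes restrict to the subgroups**: if `Inf u_E = d • u_M` in `H²(Gal(M/F), C_M)`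
(`(classData F).inf h 2`), then `relInf (res_{H_E} u_E) = d • res_{H_M} u_M` in `H²(H_M, Res C_M)` (`res_comp_relInf`).
[cite: SerreLocalFields1979, Ch. XI §3][cite: Harari2020, §16.3 Lemma 16.20] -/
theorem relInf_res_H2π_eq (U : Subgroup (absoluteGaloisGroup F)) {E M : GalLayer F} (h : E ≤ M)
    (φE : cocycles₂ ((classData F).obj E)) (φM : cocycles₂ ((classData F).obj M)) {d : ℕ}
    (hc : (classData F).inf h 2 (H2π _ φE) = d • H2π _ φM) :
    (classData F).relInf U h 2
        (groupCohomology.map (GalLayer.subgroupImage U E).subtype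
          (𝟙 (Rep.res (GalLayer.subgroupImage U E).subtype ((classData F).obj E))) 2 (H2π _ φE)) =
      d • groupCohomology.map (GalLayer.subgroupImage U M).subtype
          (𝟙 (Rep.res (GalLayer.subgroupImage U M).subtype ((classData F).obj M))) 2 (H2π _ φM) := by
  have h3 : (classData F).relInf U h 2
      (groupCohomology.map (GalLayer.subgroupImage U E).subtype
        (𝟙 (Rep.res (GalLayer.subgroupImage U E).subtype ((classData F).obj E))) 2 (H2π _ φE)) =
      groupCohomology.map (GalLayer.subgroupImage U M).subtype
        (𝟙 (Rep.res (GalLayer.subgroupImage U M).subtype ((classData F).obj M))) 2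
        ((classData F).inf h 2 (H2π _ φE)) :=
    ConcreteCategory.congr_hom ((classData F).res_comp_relInf (U := U) h 2) (H2π _ φE)
  rw [hc, map_nsmul] at h3
  exact h3

set_option maxHeartbeats 1600000 in
-- the final `Eq.trans` bridges the `ℤ`-instance paths of Mathlib's generic `H2π_mapCocycles₂_subtype` and of this
-- file's `Rep ℤ _` terms by definitional unfolding (no `rw` across the two is possible)
/-- The same in the engine's currency `[res φ]` (`H2π (Res A) (mapCocycles₂ …)`, Mathlib), i.e. the hypothesis `hι` of
`IsClassModule.map_eq_zero_of_card_dvd_plain` for `π = res : H_M → H_E`, `ι = relBaseRepHom`.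
[cite: SerreLocalFields1979, Ch. XI §3][cite: Harari2020, §16.3 Lemma 16.20] -/
theorem relInf_H2π_mapCocycles₂_eq (U : Subgroup (absoluteGaloisGroup F)) {E M : GalLayer F} (h : E ≤ M)
    (φE : cocycles₂ ((classData F).obj E)) (φM : cocycles₂ ((classData F).obj M)) {d : ℕ}
    (hc : (classData F).inf h 2 (H2π _ φE) = d • H2π _ φM) :
    groupCohomology.map (GalLayer.subgroupImageRes U h) ((classData F).relBaseRepHom h) 2
        (H2π (Rep.res (GalLayer.subgroupImage U E).subtype ((classData F).obj E))
          (mapCocycles₂ (GalLayer.subgroupImage U E).subtype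
            (𝟙 (Rep.res (GalLayer.subgroupImage U E).subtype ((classData F).obj E))) φE)) =
      d • H2π (Rep.res (GalLayer.subgroupImage U M).subtype ((classData F).obj M))
          (mapCocycles₂ (GalLayer.subgroupImage U M).subtype
            (𝟙 (Rep.res (GalLayer.subgroupImage U M).subtype ((classData F).obj M))) φM) := by
  have h1 := H2π_mapCocycles₂_subtype φE (GalLayer.subgroupImage U E)
  have h2 := H2π_mapCocycles₂_subtype φM (GalLayer.subgroupImage U M)
  have hrel := relInf_res_H2π_eq U h φE φM hc
  exact (congrArg (fun z => (classData F).relInf U h 2 z) h1).trans (hrel.trans (congrArg (fun z => d • z) h2).symm)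

set_option maxHeartbeats 1600000 in
/-- **Every relative transition `Hⁿ⁺³(H_E, Res_{H_E} C_E) → Hⁿ⁺³(H_M, Res_{H_M} C_M)` with `[E:F] ∣ [M:E]` is ZERO**
(Tate–Nakayama for the class module `(H_E, Res C_E)` — the restriction of door-c4 g11's class-module structure on
`(Gal(E/F), C_E)` — the compatible fundamental classes `Inf u_E = [M:E]·u_M` restricted to the subgroups, and
`|H_E| ∣ [E:F] ∣ [M:E]`). [cite: MilneADT2006, I Lemma 1.9][cite: Harari2020, §16.3 Lemma 16.20] -/
theorem relInf_eq_zero_of_finrank_dvd (U : Subgroup (absoluteGaloisGroup F)) {E M : GalLayer F} (h : E ≤ M)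
    (hdvd : Module.finrank F E.1 ∣ (letI := GalLayer.algebraOfLE h; Module.finrank E.1 M.1)) (n : ℕ)
    (y : groupCohomology (Rep.res (GalLayer.subgroupImage U E).subtype ((classData F).obj E)) (n + 3)) :
    (classData F).relInf U h (n + 3) y = 0 := by
  haveI := E.numberField
  haveI := M.numberField
  haveI := E.isGalois
  haveI := M.isGalois
  letI := GalLayer.algebraOfLE h
  haveI := GalLayer.isScalarTower_of_le h
  letI : Fintype (GalLayer.subgroupImage U E) := Fintype.ofFinite _
  -- compatible fundamental classes on the two layers
  obtain ⟨φE, φM, hE, -, hc⟩ :=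
    exists_isClassModule_pair_map_eq_finrank_smul (F := F) (E := E.1) (M := M.1) ((classData F).baseRepHom h)
      (classData_baseRepHom_hom_apply h)
  rw [natCast_zsmul] at hc
  have hc' : (classData F).inf h 2 (H2π _ φE) = Module.finrank E.1 M.1 • H2π _ φM := hc
  have hrel := relInf_H2π_mapCocycles₂_eq U h φE φM hc'
  -- `|H_E| ∣ [E:F] ∣ [M:E]`
  have hcard : Nat.card (GalLayer.subgroupImage U E) ∣ Module.finrank E.1 M.1 :=
    ((GalLayer.subgroupImage U E).card_subgroup_dvd_card.trans
      (by rw [IsGalois.card_aut_eq_finrank])).trans hdvd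
  exact (hE.res_mapCocycles₂ (GalLayer.subgroupImage U E)).map_eq_zero_of_card_dvd_plain
    (GalLayer.subgroupImageRes U h) ((classData F).relBaseRepHom h) _ hrel hcard n y

/-! ## §2 `Extʳ_{C_U}(ℤ, Res_U C̄) = 0` for `r ≥ 3` -/

/-- **`Extʳ_{C_U}(ℤ, Res_U C̄) = 0` for every `r ≥ 3` and every open subgroup `U ≤ Γ_F`** — the hypothesis
`Hʳ(U, C) = 0 (r ≥ 3)` of Tate's duality theorem for the idèle class formation `(Γ_F, C̄)` in door-c4's `Ext` currency
(Milne's proof of Lemma 1.9 at `U`: the relative layers die in the cyclotomic layers).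
[cite: MilneADT2006, I Theorem 1.8 and Lemma 1.9][cite: Harari2020, §16.3 Lemma 16.20] -/
theorem ext_res_classBarD_eq_zero_of_three_le (U : Subgroup (absoluteGaloisGroup F))
    (hU : IsOpen (U : Set (absoluteGaloisGroup F))) (r : ℕ) (hr : 3 ≤ r)
    (x : Abelian.Ext (DiscreteRep.triv (Γ := U) ℤ) ((DiscreteRep.resD ℤ U).obj (classBarD F)) r) : x = 0 := by
  obtain ⟨n, rfl⟩ : ∃ n, r = n + 3 := ⟨r - 3, by omega⟩
  -- `(classData F).toSystem.toD = classBarD F` definitionally (`classData_toD`)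
  refine (classData F).ext_res_eq_zero_of_forall_relInf U hU (n + 3) (fun E _ c => ?_) x
  obtain ⟨M, h, hdvd⟩ := GalLayer.exists_ge_finrank_dvd E
  exact ⟨M, h, relInf_eq_zero_of_finrank_dvd U h hdvd n c⟩

/-- **Door-c4's field `TateDualityHypotheses.ext_triv_eq_zero_of_three_le` for `C̄`**, verbatim shape: for every open
normal subgroup `U` of `Γ_F` and every `r ≥ 3`, `Extʳ_{C_U}(triv ℤ, Res_U C̄) = 0`.
[cite: MilneADT2006, I Theorem 1.8 and Lemma 1.9] -/
theorem ext_res_classBarD_eq_zero_of_three_le_openNormal (U : OpenNormalSubgroup (absoluteGaloisGroup F)) (r : ℕ)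
    (hr : 3 ≤ r)
    (x : Abelian.Ext (DiscreteRep.triv (k := ℤ) (Γ := (U : Subgroup (absoluteGaloisGroup F))) ℤ)
      ((DiscreteRep.resD ℤ (U : Subgroup (absoluteGaloisGroup F))).obj (classBarD F)) r) : x = 0 :=
  ext_res_classBarD_eq_zero_of_three_le (U : Subgroup (absoluteGaloisGroup F)) (DiscreteRep.LayerColimit.coe_isOpen U)
    r hr x

/-! ## §3 The absolute case `U = Γ_F` -/

set_option maxHeartbeats 800000 in
/-- **The transitions `Hⁿ⁺³(Gal(E/F), C_E) → Hⁿ⁺³(Gal(M/F), C_M)` of the system `classData F` vanish for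
`[E:F] ∣ [M:E]`** (door-c6 g11's `map_tensor_eq_zero_of_finrank_dvd` with the trivial factor removed).
[cite: MilneADT2006, I Lemma 1.9][cite: Harari2020, §16.3 Lemma 16.20] -/
theorem inf_eq_zero_of_finrank_dvd {E M : GalLayer F} (h : E ≤ M)
    (hdvd : Module.finrank F E.1 ∣ (letI := GalLayer.algebraOfLE h; Module.finrank E.1 M.1)) (n : ℕ)
    (y : groupCohomology ((classData F).obj E) (n + 3)) : (classData F).inf h (n + 3) y = 0 := by
  haveI := E.numberField
  haveI := M.numberField
  haveI := E.isGalois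
  haveI := M.isGalois
  letI := GalLayer.algebraOfLE h
  haveI := GalLayer.isScalarTower_of_le h
  letI : Fintype (E.1 ≃ₐ[F] E.1) := Fintype.ofFinite _
  obtain ⟨φE, φM, hE, -, hc⟩ :=
    exists_isClassModule_pair_map_eq_finrank_smul (F := F) (E := E.1) (M := M.1) ((classData F).baseRepHom h)
      (classData_baseRepHom_hom_apply h)
  rw [natCast_zsmul] at hc
  have hc' : (classData F).inf h 2 (H2π _ φE) = Module.finrank E.1 M.1 • H2π _ φM := hc
  have hcard : Nat.card (E.1 ≃ₐ[F] E.1) ∣ Module.finrank E.1 M.1 := by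
    rw [IsGalois.card_aut_eq_finrank]
    exact hdvd
  exact hE.map_eq_zero_of_card_dvd_plain (GalLayer.resHom h) ((classData F).baseRepHom h) _ hc' hcard n y

/-- **`Extʳ_{C_{Γ_F}}(ℤ, C̄) = 0` for `r ≥ 3`** — the absolute case (`Hʳ(Γ_F, C̄) = lim→ Hʳ(Gal(E/F), C_E) = 0`, Tate VII
§11.3 Thm. B in the limit), through door-c4's (d) and door-c5's `layerCohomologyIso` /
`map_invariantsStepIncl_comp_layerCohomologyIso`. [cite: MilneADT2006, I Lemma 1.9][cite: CasselsFrohlichANT1967, Ch. VII §11.3] -/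
theorem ext_classBarD_eq_zero_of_three_le (r : ℕ) (hr : 3 ≤ r)
    (x : Abelian.Ext (DiscreteRep.triv (Γ := absoluteGaloisGroup F) ℤ) (classBarD F) r) : x = 0 := by
  obtain ⟨n, rfl⟩ : ∃ n, r = n + 3 := ⟨r - 3, by omega⟩
  refine DiscreteRep.LayerColimit.ext_eq_zero_of_forall_exists_stepG_eq_zero (n + 3) (classBarD F)
    (fun V c => ?_) x
  obtain ⟨E, rfl⟩ : ∃ E : GalLayer F, E.openNormalSubgroup = V :=
    ⟨GalLayer.ofOpenNormalSubgroup V, GalLayer.openNormalSubgroup_ofOpenNormalSubgroup V⟩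
  obtain ⟨M, h, hdvd⟩ := GalLayer.exists_ge_finrank_dvd E
  refine ⟨M.openNormalSubgroup, GalLayer.coe_openNormalSubgroup_le h, ?_⟩
  -- through the layer isomorphisms the transition is `(classData F).inf h`, which vanishes
  have hsq := (classData F).map_invariantsStepIncl_comp_layerCohomologyIso h (n + 3)
  have h1 : ((classData F).layerCohomologyIso M (n + 3)).hom
      (DiscreteRep.LayerColimit.stepG E.openNormalSubgroup M.openNormalSubgroup
        (GalLayer.coe_openNormalSubgroup_le h) (classBarD F) (n + 3) c) = 0 := by
    change (DiscreteRep.LayerColimit.stepG E.openNormalSubgroup M.openNormalSubgroup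
        (GalLayer.coe_openNormalSubgroup_le h) (classData F).toSystem.toD (n + 3) ≫
        ((classData F).layerCohomologyIso M (n + 3)).hom) c = 0
    rw [hsq, CategoryTheory.comp_apply, inf_eq_zero_of_finrank_dvd h hdvd n]
  rw [← CategoryTheory.Iso.hom_inv_id_apply ((classData F).layerCohomologyIso M (n + 3))
    (DiscreteRep.LayerColimit.stepG E.openNormalSubgroup M.openNormalSubgroup
      (GalLayer.coe_openNormalSubgroup_le h) (classBarD F) (n + 3) c), h1, map_zero]
  rfl

end IdeleClassBar

end Literature.NumberTheory.GaloisRepresentations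

end
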